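import Summits.Ventures.PercRepro.MSExcessIdentities

/-!
# Theorem (MIN), the inductive steps: both halves, the closure under a minimal member, the
independence reduction

Dossier proofs/MINE1-theoremS.md, Addendum 58, Steps 3–4 and tool (T4), on the framework of
MSExcessCube.lean / MSExcessIdentities.lean.

* `exc_both_halves_eq_one`: a crossed fibre `v` over `z` differing from `c` at `f ∉ z` makes BOTH
  halves of `D` at `f` have excess one against the `f`-free subfamily (the `c`-half by (H) and
  Lemma X, the `v`-half because zero excess would close the fibre); hence, by the two identities,
  both halves have zero excess against the `f`-subfamily (`exc_halves_member_eq_zero`).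
* `union_mem_of_crossSet_halves_eq_empty`: no crossed fibre over `m` in either half means `D` is
  closed under adjoining `m`, hence independent of every coordinate of `m`.
* `crossSet_eq_of_indep`: if `D` is independent of some `g ∈ z`, the statement on `G.erase g`
  (the induction hypothesis `MinLostStmt α n`) gives `crossSet D z = {c ∖ z}`.
-/

namespace PercRepro.MSTight

open Finset

variable {α : Type*} [DecidableEq α]

section MinLost2

variable {G : Finset α} {A D : Finset (Finset α)} {c s z v m : Finset α} {f g : α}

/-- `insert f (v.erase f ∪ z) = v ∪ z` when `f ∈ v`. -/
theorem insert_erase_union (hfv : f ∈ v) : insert f (v.erase f ∪ z) = v ∪ z := by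
  ext x
  simp only [mem_insert, mem_union, mem_erase]
  constructor
  · rintro (rfl | ⟨-, hx⟩ | hx)
    · exact Or.inl hfv
    · exact Or.inl hx
    · exact Or.inr hx
  · rintro (hx | hx)
    · by_cases hxf : x = f
      · exact Or.inl hxf
      · exact Or.inr (Or.inl ⟨hxf, hx⟩)
    · exact Or.inr (Or.inr hx)

/-- Step 3, first half: a crossed fibre `v` over `z` (with `f ∉ z`) gives the `v`-half at `f` a
crossed fibre, hence excess `≥ 1`. -/
theorem one_le_exc_halfOf_of_mem_crossSet (hD : IsLowerIn G D) (hA : IsUpperIn G A)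
    (hz : IsMinIn A z) (hfz : f ∉ z) (hv : v ∈ crossSet D z) :
    1 ≤ exc (G.erase f) (halfOf D v f) (A.nonMemberSubfamily f) := by
  apply one_le_exc_of_crossSet_nonempty (isLowerIn_halfOf hD) (isUpperIn_nonMember hA)
    (isMinIn_nonMember hz hfz)
  refine ⟨v.erase f, ?_⟩
  obtain ⟨hvD, hdisj, hvz⟩ := mem_crossSet.1 hv
  rw [mem_crossSet]
  refine ⟨(erase_mem_halfOf_iff Iff.rfl).2 hvD, disjoint_of_subset_left (erase_subset f v) hdisj, ?_⟩
  intro h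
  rw [mem_halfOf] at h
  obtain ⟨-, h⟩ := h
  split_ifs at h with hfv
  · rw [insert_erase_union hfv] at h
    exact hvz h
  · rw [erase_eq_of_notMem hfv] at h
    exact hvz h

/-- Step 3: with a crossed fibre `v` differing from `c` at `f ∉ z`, both halves at `f` have excess
one against the `f`-free subfamily. -/
theorem exc_both_halves_eq_one (hD : IsLowerIn G D) (hA : IsUpperIn G A) (hH : HypH D A c)
    (h1 : exc G D A = 1) (hf : f ∈ G) (hz : IsMinIn A z) (hfz : f ∉ z) (hv : v ∈ crossSet D z)
    (hvc : f ∈ v ↔ f ∉ c) :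
    exc (G.erase f) (D.nonMemberSubfamily f) (A.nonMemberSubfamily f) = 1 ∧
    exc (G.erase f) (D.memberSubfamily f) (A.nonMemberSubfamily f) = 1 := by
  have hc := exc_halfOf_eq_one hD hA hH h1 hf hz hfz
  have hv1 := one_le_exc_halfOf_of_mem_crossSet hD hA hz hfz hv
  obtain ⟨-, h10, h00, -⟩ := exc_face_le hf hD hA
  unfold halfOf at hc hv1
  by_cases hfc : f ∈ c
  · have hfv : f ∉ v := fun h => hvc.1 h hfc
    rw [if_pos hfc] at hc
    rw [if_neg hfv] at hv1
    exact ⟨by omega, hc⟩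
  · have hfv : f ∈ v := hvc.2 hfc
    rw [if_neg hfc] at hc
    rw [if_pos hfv] at hv1
    exact ⟨hc, by omega⟩

/-- Step 3, conclusion: both halves have zero excess against the `f`-subfamily. -/
theorem exc_halves_member_eq_zero (hD : IsLowerIn G D) (hA : IsUpperIn G A) (h1 : exc G D A = 1)
    (hf : f ∈ G)
    (h00 : exc (G.erase f) (D.nonMemberSubfamily f) (A.nonMemberSubfamily f) = 1)
    (h10 : exc (G.erase f) (D.memberSubfamily f) (A.nonMemberSubfamily f) = 1) :
    exc (G.erase f) (D.nonMemberSubfamily f) (A.memberSubfamily f) = 0 ∧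
    exc (G.erase f) (D.memberSubfamily f) (A.memberSubfamily f) = 0 := by
  have i1 := exc_eq_identity₁ hf hD hA
  have i2 := exc_eq_identity₂ hf hD hA
  have n01 := exc_nonneg (isLowerIn_nonMember (e := f) hD) (isUpperIn_member hf hA)
  have n11 := exc_nonneg (isLowerIn_member (e := f) hD) (isUpperIn_member hf hA)
  constructor <;> omega

/-- If no fibre over `m` (with `f ∉ m`) is crossed by either half of `D` at `f`, then `D` is closed
under adjoining `m`. -/
theorem union_mem_of_crossSet_halves_eq_empty (hD : IsLowerIn G D) (hfm : f ∉ m)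
    (h0 : crossSet (D.nonMemberSubfamily f) m = ∅) (h1 : crossSet (D.memberSubfamily f) m = ∅) :
    ∀ u ∈ D, u ∪ m ∈ D := by
  intro u hu
  have hw : u \ m ∈ D := hD.2 sdiff_subset hu
  have hdisj : Disjoint (u \ m) m := disjoint_sdiff_self_left
  by_cases hfu : f ∈ u
  · have hfw : f ∈ u \ m := mem_sdiff.2 ⟨hfu, hfm⟩
    have hmem : (u \ m).erase f ∈ D.memberSubfamily f :=
      mem_memberSubfamily.2 ⟨by rwa [insert_erase hfw], notMem_erase f _⟩
    by_contra hum
    have : (u \ m).erase f ∈ crossSet (D.memberSubfamily f) m := by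
      refine mem_crossSet.2 ⟨hmem, disjoint_of_subset_left (erase_subset f _) hdisj, ?_⟩
      intro h
      obtain ⟨h, -⟩ := mem_memberSubfamily.1 h
      rw [insert_erase_union hfw, sdiff_union_self_eq_union] at h
      exact hum h
    rw [h1] at this
    exact absurd this (notMem_empty _)
  · have hfw : f ∉ u \ m := fun h => hfu (mem_sdiff.1 h).1
    have hmem : u \ m ∈ D.nonMemberSubfamily f := mem_nonMemberSubfamily.2 ⟨hw, hfw⟩
    by_contra hum
    have : u \ m ∈ crossSet (D.nonMemberSubfamily f) m := by
      refine mem_crossSet.2 ⟨hmem, hdisj, ?_⟩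
      intro h
      obtain ⟨h, -⟩ := mem_nonMemberSubfamily.1 h
      rw [sdiff_union_self_eq_union] at h
      exact hum h
    rw [h0] at this
    exact absurd this (notMem_empty _)

/-- Closure under adjoining `m` makes `D` independent of every `g ∈ m`. -/
theorem insert_mem_of_union_mem (hD : IsLowerIn G D) (hcl : ∀ u ∈ D, u ∪ m ∈ D) (hg : g ∈ m) :
    ∀ u ∈ D, insert g u ∈ D := by
  intro u hu
  exact hD.2 (insert_subset (mem_union_right u hg) subset_union_left) (hcl u hu)

/-- If `D` is independent of `g`, its two halves at `g` coincide. -/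
theorem member_eq_nonMember_of_indep (hD : IsLowerIn G D) (hind : ∀ u ∈ D, insert g u ∈ D) :
    D.memberSubfamily g = D.nonMemberSubfamily g := by
  ext s
  rw [mem_memberSubfamily, mem_nonMemberSubfamily]
  constructor
  · rintro ⟨h, hgs⟩
    exact ⟨hD.2 (subset_insert g s) h, hgs⟩
  · rintro ⟨h, hgs⟩
    exact ⟨hind s h, hgs⟩

/-- Independence at `g`: the excess splits into the two `A`-halves against the single `D`-half. -/
theorem exc_eq_of_indep (hD : IsLowerIn G D) (hA : IsUpperIn G A) (hg : g ∈ G)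
    (hind : ∀ u ∈ D, insert g u ∈ D) :
    exc G D A = exc (G.erase g) (D.nonMemberSubfamily g) (A.nonMemberSubfamily g) +
      exc (G.erase g) (D.nonMemberSubfamily g) (A.memberSubfamily g) := by
  have i2 := exc_eq_identity₂ hg hD hA
  rw [member_eq_nonMember_of_indep hD hind, sdiff_self, bot_eq_empty, empty_inter, card_empty] at i2
  rw [i2]
  push_cast
  ring

/-- Crossed fibres over `z ∋ g` transfer to the `g`-free half over `z.erase g` when `D` is
independent of `g`. -/
theorem crossSet_eq_crossSet_nonMember_of_indep (hD : IsLowerIn G D)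
    (hind : ∀ u ∈ D, insert g u ∈ D) (hgz : g ∈ z) :
    crossSet D z = crossSet (D.nonMemberSubfamily g) (z.erase g) := by
  ext v
  simp only [mem_crossSet, mem_nonMemberSubfamily]
  constructor
  · rintro ⟨hv, hdisj, hvz⟩
    have hgv : g ∉ v := fun h => (disjoint_left.1 hdisj) h hgz
    refine ⟨⟨hv, hgv⟩, disjoint_of_subset_right (erase_subset g z) hdisj, ?_⟩
    rintro ⟨h, -⟩
    apply hvz
    have := hind _ h
    rwa [← union_insert, insert_erase hgz] at this
  · rintro ⟨⟨hv, hgv⟩, hdisj, hvz⟩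
    refine ⟨hv, ?_, ?_⟩
    · rw [disjoint_left]
      intro x hxv hxz
      by_cases hxg : x = g
      · exact hgv (hxg ▸ hxv)
      · exact (disjoint_left.1 hdisj) hxv (mem_erase.2 ⟨hxg, hxz⟩)
    · intro h
      apply hvz
      refine ⟨hD.2 (union_subset_union (subset_refl v) (erase_subset g z)) h, ?_⟩
      simp [hgv]

end MinLost2

section MinLost3

variable {G : Finset α} {A D : Finset (Finset α)} {c s z v m w : Finset α} {f g : α}

/-- The statement proved by induction on the size of the ground set. -/
def MinLostStmt (α : Type*) [DecidableEq α] (n : ℕ) : Prop :=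
  ∀ (G : Finset α) (D A : Finset (Finset α)) (c : Finset α), G.card ≤ n → IsLowerIn G D →
    IsUpperIn G A → ∅ ∉ A → c ⊆ G → HypH D A c → exc G D A = 1 →
    ∀ z, IsMinIn A z → crossSet D z = {c \ z}

/-- `c.erase g ∖ z = c ∖ insert g z`. -/
theorem erase_sdiff_eq_sdiff_insert (c z : Finset α) (g : α) : c.erase g \ z = c \ insert g z := by
  ext x; simp only [mem_sdiff, mem_erase, mem_insert]; tauto

/-- `insert g (c.erase g ∪ z) = c ∪ insert g z`. -/
theorem insert_erase_union_eq (c z : Finset α) (g : α) :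
    insert g (c.erase g ∪ z) = c ∪ insert g z := by
  ext x; simp only [mem_insert, mem_union, mem_erase]
  constructor
  · rintro (rfl | ⟨-, h⟩ | h)
    · exact Or.inr (Or.inl rfl)
    · exact Or.inl h
    · exact Or.inr (Or.inr h)
  · rintro (h | rfl | h)
    · by_cases hx : x = g
      · exact Or.inl hx
      · exact Or.inr (Or.inl ⟨hx, h⟩)
    · exact Or.inl rfl
    · exact Or.inr (Or.inr h)

/-- (H) passes to the pair `(D.nonMemberSubfamily g, A.memberSubfamily g)` when `D` is independent
of `g`. -/
theorem HypH.nonMember_member (hD : IsLowerIn G D) (hind : ∀ u ∈ D, insert g u ∈ D)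
    (hH : HypH D A c) : HypH (D.nonMemberSubfamily g) (A.memberSubfamily g) (c.erase g) := by
  intro z₁ hz₁
  obtain ⟨h, hgz₁⟩ := mem_memberSubfamily.1 hz₁.1
  obtain ⟨h1, h2⟩ := hH.mem hD h
  constructor
  · rw [mem_nonMemberSubfamily, erase_sdiff_eq_sdiff_insert]
    exact ⟨h1, fun hg => (mem_sdiff.1 hg).2 (mem_insert_self g z₁)⟩
  · intro h'
    obtain ⟨h', -⟩ := mem_nonMemberSubfamily.1 h'
    have := hind _ h'
    rw [insert_erase_union_eq] at this
    exact h2 this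

/-- For a minimal member `z ∋ g` of `A`, `z.erase g` is a minimal member of the `g`-subfamily. -/
theorem isMinIn_member_erase (hz : IsMinIn A z) (hgz : g ∈ z) :
    IsMinIn (A.memberSubfamily g) (z.erase g) := by
  refine ⟨mem_memberSubfamily.2 ⟨by rw [insert_erase hgz]; exact hz.1, notMem_erase g z⟩, ?_⟩
  intro y hy hyz
  obtain ⟨hy, hgy⟩ := mem_memberSubfamily.1 hy
  have h := hz.2 _ hy (insert_subset hgz (hyz.trans (erase_subset g z)))
  rw [← h, erase_insert hgy]

/-- If `D` is independent of `g ∈ z` (under (H)), `∅` is not in the `g`-subfamily of `A`. -/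
theorem empty_notMem_member_of_indep (hH : HypH D A c) (hz : IsMinIn A z)
    (hgz : g ∈ z) (hind : ∀ u ∈ D, insert g u ∈ D) : ∅ ∉ A.memberSubfamily g := by
  intro h
  obtain ⟨h, -⟩ := mem_memberSubfamily.1 h
  rw [insert_empty] at h
  have hzg : z = {g} := (hz.2 {g} h (singleton_subset_iff.2 hgz)).symm
  obtain ⟨h1, h2⟩ := hH z hz
  apply h2
  have := hind _ h1
  rw [hzg] at this ⊢
  have e : insert g (c \ {g}) = c ∪ {g} := by
    ext x; simp only [mem_insert, mem_sdiff, mem_union, mem_singleton]; tauto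
  rwa [e] at this

/-- Step 4, the independence reduction: if `D` is independent of some `g ∈ z`, the induction
hypothesis on `G.erase g` gives the conclusion. -/
theorem crossSet_eq_of_indep {n : ℕ} (ih : MinLostStmt α n) (hG : G.card ≤ n + 1)
    (hD : IsLowerIn G D) (hA : IsUpperIn G A) (hc : c ⊆ G) (hH : HypH D A c)
    (h1 : exc G D A = 1) (hz : IsMinIn A z) (hgz : g ∈ z) (hind : ∀ u ∈ D, insert g u ∈ D) :
    crossSet D z = {c \ z} := by
  have hgG : g ∈ G := hA.1 z hz.1 hgz
  have hG' : (G.erase g).card ≤ n := by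
    rw [card_erase_of_mem hgG]; omega
  have hD' := isLowerIn_nonMember (e := g) hD
  have hA' := isUpperIn_member hgG hA
  have hE' := empty_notMem_member_of_indep hH hz hgz hind
  have hc' : c.erase g ⊆ G.erase g := erase_subset_erase g hc
  have hH' := hH.nonMember_member hD hind
  have hzmin := isMinIn_member_erase hz hgz
  have h1' : exc (G.erase g) (D.nonMemberSubfamily g) (A.memberSubfamily g) = 1 := by
    have e := exc_eq_of_indep hD hA hgG hind
    have n0 := exc_nonneg hD' (isUpperIn_nonMember (e := g) hA)
    have hge := one_le_exc_of_crossSet_nonempty hD' hA' hzmin ⟨_, hH'.sdiff_mem_crossSet hzmin⟩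
    omega
  have := ih (G.erase g) _ _ _ hG' hD' hA' hE' hc' hH' h1' _ hzmin
  rw [crossSet_eq_crossSet_nonMember_of_indep hD hind hgz, this]
  congr 1
  ext x; simp only [mem_sdiff, mem_erase]
  constructor
  · rintro ⟨⟨hxg, hxc⟩, hxz⟩
    exact ⟨hxc, fun h => hxz ⟨hxg, h⟩⟩
  · rintro ⟨hxc, hxz⟩
    exact ⟨⟨fun h => hxz (h ▸ hgz), hxc⟩, fun h => hxz h.2⟩

end MinLost3

end PercRepro.MSTight
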